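import Mathlib.Data.Nat.Choose.Basic
import Mathlib.Data.Rat.Defs
import Mathlib.Tactic.Linarith
import Mathlib.Tactic.NormNum
import Mathlib.Tactic.Ring
import Mathlib.Tactic.IntervalCases
import Mathlib.Tactic.LinearCombination
import Mathlib.Tactic.Positivity
import HarnessLib

/-!
# The (0,1) cell of the ι-window, XX: the product ground `B₁ × B₂`, VII — O-RIG BY UNIQUENESS: LEMMA U, LEMMA TL (the equivariant
# t-lattice), the first-frame family `Φ(L ⊗ 𝓘_Z)` (Gieseker stability for `m ≥ 4`, the `m = 3` dichotomy), and the two-parameter family of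
# readings `D(m,n)` — algebraic skeleton

Family `hodge`, b2b cell `hweil` (helper of item stmt-HodgeConjecture-2524). Report
`run/shared/lean/b2b/hodge-weil/b2b-hweil-pv1-g32/H2-ZERO-ONE-20.md` (prover 1 gen 32). Companion to `WeilTypeLadderH2ProductGroundSix.lean`
(gen 31: LEMMA α, JD, R11, FH-1/KT/K2; `pg6_*`). HONEST FRAMING: census results inside the ladder's H2 test ((0,1) cell) on the SPECIAL fourfold
`X₀ = B₁ × B₂`; emptiness / non-isolation of a family there is a census line and nothing more. No case of the Hodge conjecture is proved; nothing
here is a rung; no statement of [Markman 2025] / [Perry 2026] / [EdGFS 2025] is used. The kernel content is the elementary arithmetic of the report;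
the geometry (Mukai's Fourier functor and semi-homogeneous bundles, Yoshioka's stability method, Alagal–Maciocia's `k`-very ampleness,
Bridgeland–King–Reid) is quoted print and the cell's certified items, and every head below is a SHADOW of a named step of the report.

Conventions (as in the companions): a class on a principally polarised abelian surface with `NS = ℤθ` is `(r, c, s) ↔ r + cθ + s·pt`
(`s = χ`), Mukai pairing `⟨(r,c,s),(r',c',s')⟩ = 2cc' − rs' − r's`, `χ(E,F) = −⟨v(E),v(F)⟩`, norm `c² − rs`, slope `2c/r`.

## LEMMA U and LEMMA TL (report §2)
`pg7_u_euler`: `χ⁺ = hom⁺ − ext¹⁺ + ext²⁺ = 2` forces `hom⁺ ≥ 1 ∨ ext²⁺ ≥ 1`; and `(−2·3 + 40/4)/2 = 2`. `pg7_tl_shapes`: sixteen odd squares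
summing to `40` have magnitudes `(1¹³,3³)` or `(1¹⁵,5)`. `pg7_tl_mod8`: the `τ`-reduction — four `±1`-products shifted by a 3-set contribute
`4 (mod 8)`. `pg7_tl_counts`: `32·C(16,3) + 32·16 = 18432`, `|A| = 512 = 16·32`, `disc = 64 = 2⁶`. `pg7_norm3_not_both_even`: a norm-3 class has
`r, s` not both even.

## The first frame (report §3)
`pg7_family_classes`: for every `m`, `v_m = (m²−3,−m,1) = u₀ − 3·(1,0,0)` with `u₀ = (m²,−m,1)` isotropic; the direction identities of `D(m,0)`
and of the dual family. `pg7_psi_step`: the class map `Ψ_m` (congruence by the automorph `g₀(m) = [[m+2,−1],[m²−3,2−m]]`) fixes `v_m`, preserves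
norm and the pairing with `v_m`, and on `(c,s)`-coordinates is the stated affine recursion; `χ(S₀,Q₂) = 3s − 6`, `χ(P_z,Q₂) = s`.
`pg7_invariant_J`, `pg7_invariant_J1`: the inductive invariants along `n ≥ 0` and their consequences (ranks `≥ 5`, slope windows).
`pg7_neg_side`: `D(m,−1)` has a negative-rank `B₁`-class. `pg7_stab_m_ge_4`, `pg7_stab_m3`: the Gieseker-destabiliser numerics of `Φ(L ⊗ 𝓘_Z)`
(`m ≥ 4`: none; `m = 3`: only `(a₁,d₁,l₁) = (4,2,1)`). `pg7_equal_slope`: the `μ`-Jordan–Hölder exclusion for `3 ∣ m`. `pg7_m3_destab`: the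
`m = 3` bookkeeping (`(4,−2,1)` isotropic, quotient `(2,−1,0)` of norm `1`, `p`-comparison, `T = 0 ⟹ e^± = (1,1)`, `(6,−3,1) ⊗ T = (6,3,1)`).
`pg7_m3_dual_quotients`: the quotient `p`-values certifying Gieseker stability of the duals. `pg7_m3_reverse_chi`: `χ(Φ(N), Q₂) = −2c − 2s − 6 ≥ 6`.
-/

-- mandated namespace `Summit.HodgeConjecture.HodgeConjecture.…` (Problem = Summit) trips `linter.dupNamespace`; the lakefile disables it
-- tree-wide (weak option), restated here so stand-alone elaboration is warning-free too.
set_option linter.dupNamespace false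

namespace Summit.HodgeConjecture.HodgeConjecture.WeilTypeLadder

section ProductGroundSeven

/-! ### LEMMA U and LEMMA TL (report §2) -/

/-- **LEMMA U, the Euler step (report §2.1).** For ι-equivariant sheaves `R, F` with `⟨v,v⟩ = 6` and `‖t‖² = 40` in common,
`χ⁺(R,F) = (χ + T/4)/2 = (−6 + 10)/2 = 2`; and whenever `hom⁺ − ext¹⁺ + ext²⁺ = 2` one of `hom⁺`, `ext²⁺ = hom⁺(F,R)^*` is non-zero —
so there is an invariant morphism one way, which between a Gieseker-stable and a Gieseker-semistable sheaf of the same Hilbert polynomial is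
an isomorphism. [shadow: the arithmetic only] -/
theorem pg7_u_euler :
    ((-(2 : ℤ) * 3 + 40 / 4) / 2 = 2) ∧
    (∀ h0 e1 h2 : ℕ, (h0 : ℤ) - e1 + h2 = 2 → 1 ≤ h0 ∨ 1 ≤ h2) := by
  refine ⟨by norm_num, ?_⟩
  intro h0 e1 h2 h
  omega

/-- **LEMMA TL, the two shapes (report §2.3).** If sixteen ODD integers have squares summing to `40`, then — writing `n₁, n₃, n₅` for the
number of entries of absolute value `1, 3, 5` and `q ≥ 49·n₇` for the contribution of the `n₇` entries of absolute value `≥ 7` (`q = 0` if `n₇ = 0`) — the magnitude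
pattern is `(1¹³, 3³)` (three half-periods: `𝓘_Z`) or `(1¹⁵, 5¹)` (a fat point: `𝓘_{𝔪_w²}`). [shadow: the counting] -/
theorem pg7_tl_shapes (n1 n3 n5 n7 q : ℕ) (hcount : n1 + n3 + n5 + n7 = 16) (hq : 49 * n7 ≤ q) (hq0 : n7 = 0 → q = 0)
    (hsum : n1 + 9 * n3 + 25 * n5 + q = 40) :
    (n1 = 13 ∧ n3 = 3 ∧ n5 = 0 ∧ n7 = 0) ∨ (n1 = 15 ∧ n3 = 0 ∧ n5 = 1 ∧ n7 = 0) := by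
  have h7 : n7 = 0 := by omega
  have hq' : q = 0 := hq0 h7
  omega

/-- **LEMMA TL, the `τ`-reduction (report §2.3).** For signs `u_z, τ_z ∈ {±1}` at the three points of `Z`, `4·Σ_{z∈Z} u_zτ_z ≡ 4 (mod 8)`
(a sum of three signs is odd); likewise `4·uτ ≡ 4 (mod 8)` for one fat point. Hence the dual admissibility conditions for
`t = τ ⊙ (1 − 4·1_Z)` resp. `τ ⊙ (1 + 4δ_w)` do not depend on `Z` / `w`. [shadow: parity] -/
theorem pg7_tl_mod8 (a b c : ℤ) (ha : a = 1 ∨ a = -1) (hb : b = 1 ∨ b = -1) (hc : c = 1 ∨ c = -1) :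
    (4 * (a + b + c)) % 8 = 4 ∧ (4 * a) % 8 = 4 := by
  rcases ha with rfl | rfl <;> rcases hb with rfl | rfl <;> rcases hc with rfl | rfl <;> decide

/-- **LEMMA TL, the counts (report §2.3–2.4).** Realised classes for `v₁ = (1,0,−3)`: `2·16·(C(16,3) + 16) = 18432`; dual-admissible `τ`:
`512 = 32·16` (index `16 = |Λ*/Λ|` over the realised `32`); the discriminant of the equivariant numerical lattice is `64 = 2⁶`
(`= |disc NS(Km B)|`, discriminant group `(ℤ/2)⁴ × ℤ/4` of order `2⁴·4`). [shadow: numerals] -/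
theorem pg7_tl_counts :
    Nat.choose 16 3 = 560 ∧ 2 * 16 * (Nat.choose 16 3 + 16) = 18432 ∧ (512 : ℕ) = 32 * 16 ∧ (64 : ℕ) = 2 ^ 6 ∧ (2 : ℕ) ^ 4 * 4 = 64 := by
  refine ⟨by decide, by decide, by norm_num, by norm_num, by norm_num⟩

/-- **Norm-3 classes are primitive forms of discriminant 12 (report §2.4).** If `c² − rs = 3` then `r` and `s` are not both even
(else `c² ≡ 3 (mod 4)`), so the associated form `[r, 2c, s]` is primitive of discriminant `12`. [shadow: residues mod 4] -/
theorem pg7_norm3_not_both_even (r c s : ℤ) (h : c ^ 2 - r * s = 3) : ¬ (2 ∣ r ∧ 2 ∣ s) := by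
  rintro ⟨⟨a, rfl⟩, ⟨b, rfl⟩⟩
  rcases Int.even_or_odd c with ⟨k, rfl⟩ | ⟨k, rfl⟩
  · have : (k + k) ^ 2 - 2 * a * (2 * b) = 4 * (k ^ 2 - a * b) := by ring
    omega
  · have : (2 * k + 1) ^ 2 - 2 * a * (2 * b) = 4 * (k ^ 2 + k - a * b) + 1 := by ring
    omega

/-! ### The first frame: classes and the class map `Ψ_m` (report §3–§4) -/

/-- **The first-frame family, classes (report §3.1, §4.1).** For every integer `m`: `v_m = (m²−3, −m, 1)` has norm `3` and equals
`u₀ − 3·(1,0,0)` with `u₀ = (m², −m, 1)` isotropic (the classes of `Φ(L ⊗ 𝓘_Z)`, `Φ(L)`, `Φ(k(z))`); the `n = 0` partner classes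
`w₂ = (2m(m+2), −2(m+1), 2)` and `w₁ = (4m+6, −2, 0)` have norm `4` and pairings `⟨v_m,w₂⟩ = 6`, `⟨v_m,w₁⟩ = −6`, `⟨u₀,w₂⟩ = 0` (χ-NEUTRAL),
`⟨(1,0,0),w₂⟩ = −2`, `⟨u₀,w₁⟩ = −6`, `⟨(1,0,0),w₁⟩ = 0`; the direction `D(m,0) = (−(m+2), m+1)` has `(b−a)² − 3a² = m² − 3` and
`−2a(a+2b) = 2m(m+2)`; the dual-family direction `(−(4m−7), 3m−5)` has `(b−a)² − 3a² = m² − 3` as well. [shadow: `ring`] -/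
theorem pg7_family_classes (m : ℤ) :
    ((-m) ^ 2 - (m ^ 2 - 3) * 1 = 3) ∧ ((-m) ^ 2 - m ^ 2 * 1 = 0) ∧
    ((m ^ 2 - 3, -m, (1 : ℤ)) = (m ^ 2 - 3 * 1, -m - 3 * 0, 1 - 3 * 0)) ∧
    ((-2 * (m + 1)) ^ 2 - (2 * m * (m + 2)) * 2 = 4) ∧ ((-2 : ℤ) ^ 2 - (4 * m + 6) * 0 = 4) ∧
    (2 * (-m) * (-2 * (m + 1)) - (m ^ 2 - 3) * 2 - (2 * m * (m + 2)) * 1 = 6) ∧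
    (2 * (-m) * (-2) - (m ^ 2 - 3) * 0 - (4 * m + 6) * 1 = -6) ∧
    (2 * (-m) * (-2 * (m + 1)) - m ^ 2 * 2 - (2 * m * (m + 2)) * 1 = 0) ∧
    (2 * 0 * (-2 * (m + 1)) - 1 * 2 - (2 * m * (m + 2)) * 0 = -2) ∧
    (2 * (-m) * (-2) - m ^ 2 * 0 - (4 * m + 6) * 1 = -6) ∧
    (2 * 0 * (-2) - 1 * 0 - (4 * m + 6) * 0 = (0 : ℤ)) ∧
    (((m + 1) - (-(m + 2))) ^ 2 - 3 * (-(m + 2)) ^ 2 = m ^ 2 - 3) ∧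
    (-2 * (-(m + 2)) * (-(m + 2) + 2 * (m + 1)) = 2 * m * (m + 2)) ∧
    (((3 * m - 5) - (-(4 * m - 7))) ^ 2 - 3 * (-(4 * m - 7)) ^ 2 = m ^ 2 - 3) := by
  refine ⟨by ring, by ring, by simp, by ring, by ring, by ring, by ring, by ring, by ring, by ring, by ring, by ring, by ring, by ring⟩

/-- **The class map `Ψ_m` (report §4.2).** Congruence by the automorph `g₀(m) = [[m+2, −1],[m²−3, 2−m]]` of the form of `v_m` sends
`(r,c,s) ↦ ((m+2)²r + 2(m+2)(m²−3)c + (m²−3)²s, −(m+2)r + (7−2m²)c + (m²−3)(2−m)s, r + 2(m−2)c + (m−2)²s)`; it FIXES `v_m`, PRESERVES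
the norm and the pairing with `v_m`; on a class with `⟨v_m, w⟩ = 6` (so `r = −2mc − (m²−3)s − 6`) its `(c,s)`-part is
`c' = (4m+7)c + 4(m²−3)s + 6(m+2)`, `s' = −4c − (4m−7)s − 6`, and `χ(S₀-piece, w) = −⟨u₀,w⟩ = 3s − 6`, `χ(P_z, w) = s`; with
`⟨v_m,w⟩ = −6` (the `B₁` side) the constants flip: `c' = … − 6(m+2)`, `s' = … + 6`, `−⟨u₀,w⟩ = 3s + 6`. [shadow: `ring`] -/
theorem pg7_psi_step (m r c s : ℤ) :
    (((m + 2) ^ 2 * (m ^ 2 - 3) + 2 * (m + 2) * (m ^ 2 - 3) * (-m) + (m ^ 2 - 3) ^ 2 * 1,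
      -(m + 2) * (m ^ 2 - 3) + (7 - 2 * m ^ 2) * (-m) + (m ^ 2 - 3) * (2 - m) * 1,
      (m ^ 2 - 3) + 2 * (m - 2) * (-m) + (m - 2) ^ 2 * 1) = (m ^ 2 - 3, -m, (1 : ℤ))) ∧
    ((-(m + 2) * r + (7 - 2 * m ^ 2) * c + (m ^ 2 - 3) * (2 - m) * s) ^ 2
      - ((m + 2) ^ 2 * r + 2 * (m + 2) * (m ^ 2 - 3) * c + (m ^ 2 - 3) ^ 2 * s) * (r + 2 * (m - 2) * c + (m - 2) ^ 2 * s)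
      = c ^ 2 - r * s) ∧
    (2 * (-m) * (-(m + 2) * r + (7 - 2 * m ^ 2) * c + (m ^ 2 - 3) * (2 - m) * s)
      - (m ^ 2 - 3) * (r + 2 * (m - 2) * c + (m - 2) ^ 2 * s)
      - ((m + 2) ^ 2 * r + 2 * (m + 2) * (m ^ 2 - 3) * c + (m ^ 2 - 3) ^ 2 * s) * 1
      = 2 * (-m) * c - (m ^ 2 - 3) * s - r * 1) ∧
    (r = -2 * m * c - (m ^ 2 - 3) * s - 6 →
      (-(m + 2) * r + (7 - 2 * m ^ 2) * c + (m ^ 2 - 3) * (2 - m) * s = (4 * m + 7) * c + 4 * (m ^ 2 - 3) * s + 6 * (m + 2)) ∧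
      (r + 2 * (m - 2) * c + (m - 2) ^ 2 * s = -4 * c - (4 * m - 7) * s - 6) ∧
      (-(2 * (-m) * c - m ^ 2 * s - r * 1) = 3 * s - 6) ∧ (-(2 * 0 * c - 1 * s - r * 0) = s)) ∧
    (r = -2 * m * c - (m ^ 2 - 3) * s + 6 →
      (-(m + 2) * r + (7 - 2 * m ^ 2) * c + (m ^ 2 - 3) * (2 - m) * s = (4 * m + 7) * c + 4 * (m ^ 2 - 3) * s - 6 * (m + 2)) ∧
      (r + 2 * (m - 2) * c + (m - 2) ^ 2 * s = -4 * c - (4 * m - 7) * s + 6) ∧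
      (-(2 * (-m) * c - m ^ 2 * s - r * 1) = 3 * s + 6)) := by
  refine ⟨?_, by ring, by ring, ?_, ?_⟩
  · simp only [Prod.mk.injEq]; exact ⟨by ring, by ring, by ring⟩
  · intro hr; subst hr; exact ⟨by ring, by ring, by ring, by ring⟩
  · intro hr; subst hr; exact ⟨by ring, by ring, by ring⟩

/-- **Invariant (J) along the family, `B₂` side (report §4.2).** If `m ≥ 3`, `s ≥ 2` and `−c ≥ (m+1)s`, then for the next class
`c' = (4m+7)c + 4(m²−3)s + 6(m+2)`, `s' = −4c − (4m−7)s − 6`: again `−c' ≥ (m+1)s'`, and `s' ≥ 11s − 6 ≥ 16 > s`; moreover the present class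
has rank `r = −2mc − (m²−3)s − 6 ≥ 5`, `c < 0` (so `μ(Q₂) < 0 = μ(P_z)`) and `mc + r > 0` (so `μ(Q₂) = 2c/r > −2/m = μ(S₀)`).
Started at `(c,s) = (−2(m+1), 2)` this gives, for every `n ≥ 0`: `s = 2` iff `n = 0`, `χ(S₀,Q₂) = 3s − 6 = 0` at `n = 0` and `≥ 42` for
`n ≥ 1`, and the slope window of LEMMA FH / LEMMA JD. [shadow: the induction step] -/
theorem pg7_invariant_J (m c s : ℤ) (hm : 3 ≤ m) (hs : 2 ≤ s) (hJ : (m + 1) * s ≤ -c) :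
    let c' := (4 * m + 7) * c + 4 * (m ^ 2 - 3) * s + 6 * (m + 2)
    let s' := -4 * c - (4 * m - 7) * s - 6
    let r := -2 * m * c - (m ^ 2 - 3) * s - 6
    (m + 1) * s' ≤ -c' ∧ 11 * s - 6 ≤ s' ∧ 16 ≤ s' ∧ s < s' ∧ 5 ≤ r ∧ c < 0 ∧ 0 < m * c + r ∧ 0 < r ∧
    ((m + 1) * 2 ≤ -(-2 * (m + 1))) := by
  intro c' s' r
  -- write A := −c − (m+1)s ≥ 0
  have hA : 0 ≤ -c - (m + 1) * s := by linarith
  have hms : 0 ≤ (m - 3) * s := mul_nonneg (by linarith) (by linarith)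
  have key1 : -c' - (m + 1) * s' = 3 * (-c - (m + 1) * s) + 8 * s - 6 := by
    simp only [c', s']; ring
  have key2 : s' = 4 * (-c - (m + 1) * s) + 11 * s - 6 := by simp only [s']; ring
  have key3 : m * c + r = m * (-c - (m + 1) * s) + (m + 3) * s - 6 := by simp only [r]; ring
  have key4 : r = 2 * m * (-c - (m + 1) * s) + (m ^ 2 + 2 * m + 3) * s - 6 := by simp only [r]; ring
  have hm0 : 0 ≤ m := by linarith
  have t1 : 0 ≤ m * (-c - (m + 1) * s) := mul_nonneg hm0 hA
  have t2 : 0 ≤ 2 * m * (-c - (m + 1) * s) := by nlinarith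
  have t3 : (m + 3) * s ≥ 6 * 2 := by nlinarith
  have t4 : (m ^ 2 + 2 * m + 3) * s ≥ 18 * 2 := by nlinarith
  refine ⟨by linarith [key1], by linarith [key2], by linarith [key2], by linarith [key2], by linarith [key4], by nlinarith, by
    linarith [key3], by linarith [key4], by linarith⟩

/-- **Invariant (J1) along the family, `B₁` side (report §4.2).** If `m ≥ 3`, `s₁ ≥ 0` and `−c₁ ≥ (m+1)s₁ + 2`, then for
`c₁' = (4m+7)c₁ + 4(m²−3)s₁ − 6(m+2)`, `s₁' = −4c₁ − (4m−7)s₁ + 6`: again `−c₁' ≥ (m+1)s₁' + 2`, `s₁' ≥ 11s₁ + 14`, and the present class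
has rank `r₁ = −2mc₁ − (m²−3)s₁ + 6 ≥ 5`, `c₁ < 0`, `mc₁ + r₁ > 0`; started at `(c₁,s₁) = (−2, 0)`. So the `B₁`-class of `D(m,n)` has
positive rank (bi-positivity) and `μ(S₀) < μ(Q₁) < 0`; `χ(S₀,Q₁) = 3s₁ + 6` (`= 6` at `n = 0`), `χ(P_z,Q₁) = s₁` (`= 0` at `n = 0`). [shadow] -/
theorem pg7_invariant_J1 (m c s : ℤ) (hm : 3 ≤ m) (hs : 0 ≤ s) (hJ : (m + 1) * s + 2 ≤ -c) :
    let c' := (4 * m + 7) * c + 4 * (m ^ 2 - 3) * s - 6 * (m + 2)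
    let s' := -4 * c - (4 * m - 7) * s + 6
    let r := -2 * m * c - (m ^ 2 - 3) * s + 6
    (m + 1) * s' + 2 ≤ -c' ∧ 11 * s + 14 ≤ s' ∧ 5 ≤ r ∧ c < 0 ∧ 0 < m * c + r ∧
    ((m + 1) * 0 + 2 ≤ -(-2 : ℤ)) := by
  intro c' s' r
  have hA : 0 ≤ -c - (m + 1) * s - 2 := by linarith
  have key1 : -c' - (m + 1) * s' - 2 = 3 * (-c - (m + 1) * s - 2) + 8 * s + 10 := by
    simp only [c', s']; ring
  have key2 : s' = 4 * (-c - (m + 1) * s - 2) + 11 * s + 14 := by simp only [s']; ring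
  have key3 : m * c + r = m * (-c - (m + 1) * s - 2) + (m + 3) * s + 2 * m + 6 := by simp only [r]; ring
  have key4 : r = 2 * m * (-c - (m + 1) * s - 2) + (m ^ 2 + 2 * m + 3) * s + 4 * m + 6 := by simp only [r]; ring
  have hm0 : 0 ≤ m := by linarith
  have t1 : 0 ≤ m * (-c - (m + 1) * s - 2) := mul_nonneg hm0 hA
  have t3 : 0 ≤ (m + 3) * s := mul_nonneg (by linarith) hs
  have t4 : 0 ≤ (m ^ 2 + 2 * m + 3) * s := mul_nonneg (by nlinarith) hs
  refine ⟨by linarith [key1], by linarith [key2], by linarith [key4], by nlinarith, by linarith [key3], by norm_num⟩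

/-- **The negative side of the orbit (report §4.3).** `D(m,−1)` carries the `B₁`-class `−(2m(m−2), −2(m−1), 2)`, of NEGATIVE rank for
`m ≥ 3` while its `A`-classes have positive rank: not a bi-positive sheaf reading. [shadow: the sign] -/
theorem pg7_neg_side (m : ℤ) (hm : 3 ≤ m) : -(2 * m * (m - 2)) < 0 ∧ 0 < m ^ 2 - 3 := by
  constructor <;> nlinarith

/-! ### Gieseker stability of `Φ(L ⊗ 𝓘_Z)` (report §3) -/

/-- **THEOREM ST for `m ≥ 4`: no Gieseker destabiliser (report §3.3).** A destabilising subsheaf `F₁ ⊂ F = Φ(L ⊗ 𝓘_Z)` (`L ≡ mθ`,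
`rk F = m² − 3`) would have rank `1 ≤ a₁ ≤ m² − 4`, `c₁(F₁) = −d₁θ̂` with `d₁ ≥ 1`, slope inequality `d₁(m²−3) ≤ a₁ m`, Euler characteristic
`l₁ ≥ 1` (WIT₂ with non-zero torsion-free transform) and `a₁ l₁ ≤ d₁²` (`⟨v(F₁)²⟩ ≥ 0`). For `m ≥ 4` these are inconsistent. [shadow: the
whole arithmetic of the proof] -/
theorem pg7_stab_m_ge_4 (m a₁ d₁ l₁ : ℤ) (hm : 4 ≤ m) (ha : 1 ≤ a₁) (ha' : a₁ ≤ m ^ 2 - 4) (hd : 1 ≤ d₁) (hl : 1 ≤ l₁)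
    (hslope : d₁ * (m ^ 2 - 3) ≤ a₁ * m) (hbog : a₁ * l₁ ≤ d₁ ^ 2) : False := by
  have h1 : a₁ ≤ d₁ ^ 2 := by nlinarith
  have hm0 : 0 < m := by linarith
  -- d₁ < m
  have h2 : d₁ * (m ^ 2 - 3) ≤ (m ^ 2 - 4) * m := by nlinarith
  have h3 : d₁ < m := by nlinarith
  have h4 : d₁ ≤ m - 1 := by linarith
  -- m² − 3 ≤ d₁ m
  have h5 : d₁ * (m ^ 2 - 3) ≤ d₁ ^ 2 * m := by nlinarith
  have h6 : m ^ 2 - 3 ≤ d₁ * m := by nlinarith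
  have h7 : d₁ * m ≤ (m - 1) * m := by nlinarith
  nlinarith

/-- **THEOREM ST for `m = 3`: the unique destabiliser type (report §3.4).** With `m = 3` (`rk F = 6`, `μ(F) = −1`) the same constraints
force `(a₁, d₁, l₁) = (4, 2, 1)`: a Gieseker-stable subsheaf of class `(4, −2θ̂, 1)` — isotropic, hence a simple semi-homogeneous bundle
`Φ(N)`, `N ≡ 2θ`, of the same slope `−1` and larger `χ/rk = 1/4 > 1/6`. [shadow: bounded case analysis] -/
theorem pg7_stab_m3 (a₁ d₁ l₁ : ℤ) (ha : 1 ≤ a₁) (ha' : a₁ ≤ 5) (hd : 1 ≤ d₁) (hl : 1 ≤ l₁)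
    (hslope : d₁ * 6 ≤ a₁ * 3) (hbog : a₁ * l₁ ≤ d₁ ^ 2) : a₁ = 4 ∧ d₁ = 2 ∧ l₁ = 1 := by
  have hd' : d₁ ≤ 2 := by linarith
  have h1 : a₁ ≤ d₁ ^ 2 := by nlinarith
  interval_cases d₁
  · -- d₁ = 1: a₁ ≤ 1 but 6 ≤ 3a₁
    omega
  · -- d₁ = 2: 4 ≤ a₁ ≤ 4, then l₁ = 1
    have : a₁ = 4 := by omega
    subst this
    refine ⟨rfl, rfl, by nlinarith⟩

/-- **The `μ`-Jordan–Hölder exclusion for `3 ∣ m` (report §3.3).** When `m = 3k`, an equal-slope `μ`-stable saturated piece of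
`Φ(L ⊗ 𝓘_Z)` has rank `j(3k² − 1)` and `c₁ = −jkθ̂` for `j ∈ {1,2}`, Euler characteristic `l ≥ 1`, and `⟨v²⟩ ≥ 0` reads
`j(3k²−1)·l ≤ (jk)²`. The only solution is `(j,k,l) = (2,1,1)`, i.e. `m = 3` and the class `(4,−2,1)` again; for `m = 6, 9, …` the bundle is
`μ`-STABLE. [shadow: the inequality] -/
theorem pg7_equal_slope (k j l : ℤ) (hk : 1 ≤ k) (hj : j = 1 ∨ j = 2) (hl : 1 ≤ l)
    (h : j * (3 * k ^ 2 - 1) * l ≤ (j * k) ^ 2) : j = 2 ∧ k = 1 ∧ l = 1 := by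
  rcases hj with rfl | rfl
  · exfalso
    have h2 : 3 * k ^ 2 - 1 ≤ (3 * k ^ 2 - 1) * l := le_mul_of_one_le_right (by nlinarith) hl
    have h3 : (1 : ℤ) * (3 * k ^ 2 - 1) * l = (3 * k ^ 2 - 1) * l := by ring
    have h4 : ((1 : ℤ) * k) ^ 2 = k ^ 2 := by ring
    rw [h3, h4] at h
    nlinarith
  · have h2 : 2 * (3 * k ^ 2 - 1) ≤ 2 * (3 * k ^ 2 - 1) * l := le_mul_of_one_le_right (by nlinarith) hl
    have h4 : ((2 : ℤ) * k) ^ 2 = 4 * k ^ 2 := by ring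
    rw [h4] at h
    have h1 : 2 * (3 * k ^ 2 - 1) ≤ 4 * k ^ 2 := le_trans h2 h
    have hk1 : k = 1 := by nlinarith
    subst hk1
    refine ⟨rfl, rfl, by nlinarith⟩

/-- **The `m = 3` bookkeeping (report §3.4–3.5).** `(4,−2,1)` is isotropic; `(6,−3,1) − (4,−2,1) = (2,−1,0)` has norm `1` (the unit class);
the reduced-Hilbert-polynomial comparisons `1/4 > 1/6 > 0/2`; `χ(Φ(N), unit) = −⟨(4,−2,1),(2,−1,0)⟩ = −2` and with `‖t_N‖² = 16`,
`‖t_K‖² = 24`, `‖t_N + t_K‖² = 40` the cross term `T` vanishes, so `e^± = 1 ∓ T/8 = (1,1)`: exactly one invariant non-split extension on each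
sign; `(6,−3,1) ⊗ 𝒪(Θ) = (6,3,1)`; `Ext¹(N, ξ)`: degree `3 − 4 = −1` on a genus-2 curve gives `h¹ = 2`. [shadow: numerals] -/
theorem pg7_m3_destab :
    ((-2 : ℤ) ^ 2 - 4 * 1 = 0) ∧ (((6 : ℤ) - 4, (-3 : ℤ) - (-2), (1 : ℤ) - 1) = (2, -1, 0)) ∧ ((-1 : ℤ) ^ 2 - 2 * 0 = 1) ∧
    ((1 : ℚ) / 6 < 1 / 4 ∧ (0 : ℚ) / 2 < 1 / 6) ∧
    (-(2 * (-2 : ℤ) * (-1) - 4 * 0 - 2 * 1) = -2) ∧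
    (∀ T : ℤ, 16 + 24 + 2 * T = 40 → T = 0 ∧ 1 - T / 8 = 1 ∧ 1 + T / 8 = 1) ∧
    (((6 : ℤ), -3 + 6, 1 + 2 * (-3) + 6) = (6, 3, 1)) ∧
    ((2 : ℤ) - 1 - (3 - 4) = 2) := by
  refine ⟨by norm_num, by norm_num, by norm_num, ⟨by norm_num, by norm_num⟩, by norm_num, ?_, by norm_num, by norm_num⟩
  intro T hT
  have : T = 0 := by omega
  subst this
  exact ⟨rfl, by norm_num, by norm_num⟩

/-- **Gieseker stability of the duals at `m = 3` (report §3.5).** The slope-`1` torsion-free quotients of `F^∨ = {U'^∨ ↪ F^∨ ↠ Φ(N)^∨}`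
(class `(6,3,1)`, `p = χ/rk = 1/6`) have `χ/rk ∈ {1/4} ∪ {ℓ/2 : ℓ ≥ 1} ∪ {(1+ℓ)/4 : ℓ ≥ 1}`, all `> 1/6`; whereas the reverse extensions
`R` (class `(6,−3,1)`) have the quotient `K^∨`-dual data `0/2 < 1/6` on the dual side: `R` Gieseker-stable, `R^∨` not. [shadow: the
rational inequalities] -/
theorem pg7_m3_dual_quotients (ℓ : ℕ) (hℓ : 1 ≤ ℓ) :
    (1 : ℚ) / 6 < 1 / 4 ∧ (1 : ℚ) / 6 < (ℓ : ℚ) / 2 ∧ (1 : ℚ) / 6 < (1 + (ℓ : ℚ)) / 4 ∧ (0 : ℚ) / 2 < 1 / 6 := by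
  have hℓ' : (1 : ℚ) ≤ ℓ := by exact_mod_cast hℓ
  refine ⟨by norm_num, by linarith, by linarith, by norm_num⟩

/-- **Reverse-extension type is EMPTY along `D(3,n)` (report §4.4).** For `m = 3` and a `B₂`-class `w = (r,c,s)` with `⟨v₃,w⟩ = 6`
(`r = −6c − 6s − 6`): `χ(Φ(N), Q₂) = −⟨(4,−2,1), w⟩ = −2c − 2s − 6`, which is `≥ 6` under invariant (J) (`−c ≥ 4s`, `s ≥ 2`); together
with `μ(Q₂) > μ(S₀) = −2/3 > −1 = μ(Φ(N))` this gives `hom(R₂,Q₂) ≥ hom(Φ(N),Q₂) ≥ 6` for every reverse-extension `R₂ ↠ Φ(N)`. [shadow] -/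
theorem pg7_m3_reverse_chi (c s : ℤ) (hs : 2 ≤ s) (hJ : 4 * s ≤ -c) :
    -(2 * (-2) * c - 4 * s - (-6 * c - 6 * s - 6) * 1) = -2 * c - 2 * s - 6 ∧ 6 ≤ -2 * c - 2 * s - 6 := by
  constructor
  · ring
  · linarith

/-- **Where Yoshioka's general bound sits (report §3.6).** [Yos01, Thm 4.18] with `(r₀, l, ⟨v²⟩) = (1, 1, 6)` needs
`d/(r₀l) > max{4lr₀² + 1, 2r₀⟨v²⟩} = 12`, i.e. `m ≥ 13`; the specialised lattice argument of §3.3 needs only `m ≥ 4`, and `m = 3` is the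
genuine exception. [shadow: the two thresholds] -/
theorem pg7_yoshioka_threshold : max (4 * 1 * 1 ^ 2 + 1) (2 * 1 * 6) = (12 : ℤ) ∧ (12 : ℤ) < 13 ∧ ¬ ((12 : ℤ) < 4) := by
  refine ⟨by norm_num, by norm_num, by norm_num⟩

/-! ### ADDENDUM 1 — the second family: classes `(3b²−1, ∓3b, 3)` by Farey adjacency (report §12) -/

/-- **LEMMA FAREY, the arithmetic (report §12.2).** The slopes `μ(S) = −2/b` of the semi-homogeneous pieces `S_z = Φ(P_z(bΘ))` and
`μ(G) = −6b/(3b²−1)` of `G = ker(⊕S_z ↠ P_x)` are Farey neighbours (`3b·b − (3b²−1)·1 = 1`), so no subsheaf slope can sit between them: if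
`a ≤ 3b² − 2` (a proper rank), `a < b·d` (slope `< μ(S)`) and `d(3b²−1) ≤ 3b·a` (slope `≥ μ(G)`), contradiction. Hence — given that every
slope-`μ(S)` subsheaf of `⊕S_z` maps non-trivially to `P_x` — `G` is `μ`-STABLE for every `b ≥ 1`. [shadow: the whole arithmetic] -/
theorem pg7_farey (b a d : ℤ) (hb : 1 ≤ b) (ha2 : a ≤ 3 * b ^ 2 - 2) (h1 : a < b * d)
    (h2 : d * (3 * b ^ 2 - 1) ≤ 3 * b * a) : False := by
  have h3 : a + 1 ≤ b * d := by linarith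
  -- d ≤ 3b − 1 from h2 and a ≤ 3b² − 2
  have h4 : d * (3 * b ^ 2 - 1) ≤ 3 * b * (3 * b ^ 2 - 2) := by nlinarith
  have h5 : d < 3 * b := by nlinarith
  -- d ≥ 3b from 3b·(a+1) ≤ 3b²d and d(3b²−1) ≤ 3b a
  have h6 : 3 * b * (a + 1) ≤ 3 * b ^ 2 * d := by nlinarith
  nlinarith

/-- **The second family, classes (report §12.1, §12.4).** For every integer `b`: `v′_b = (3b²−1, −3b, 3) = 3·(b², −b, 1) − (1,0,0)` has norm
`3` and the pieces `u_S = (b², −b, 1)` are isotropic; the Farey identity `3b·b − (3b²−1) = 1`; the `n = 0` partner classes `w₂ = (2b(3b+2),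
−2(3b+1), 6)`, `w₁ = (4b+2, −2, 0)` have norm `4` and pairings `⟨v′_b,w₂⟩ = 6`, `⟨v′_b,w₁⟩ = −6`, `3⟨u_S,w₂⟩ = 0` (the pieces `⊕S_z` are
χ-NEUTRAL on `B₂`), `⟨(1,0,0),w₂⟩ = −6`, `⟨(1,0,0),w₁⟩ = 0` (`P_x` is χ-neutral on `B₁`), `3⟨u_S,w₁⟩ = −6`; the direction `(b, b+1)` has rank
form value `1 − 3b²` (type C); and RESCALING: with `m = 3b` the first family's classes `(2m(m+2), −2(m+1), 2)`, `(4m+6, −2, 0)` are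
`(3·rk w₂, c(w₂), s(w₂)/3)`, `(3·rk w₁, c(w₁), s(w₁)/3)`. [shadow: `ring`] -/
theorem pg7_family2_classes (b : ℤ) :
    ((-3 * b) ^ 2 - (3 * b ^ 2 - 1) * 3 = 3) ∧ ((3 * b ^ 2 - 1, -3 * b, (3 : ℤ)) = (3 * b ^ 2 - 1 * 1, 3 * (-b) - 0, 3 * 1 - 0)) ∧
    ((-b) ^ 2 - b ^ 2 * 1 = 0) ∧ (3 * b * b - (3 * b ^ 2 - 1) * 1 = 1) ∧
    ((-2 * (3 * b + 1)) ^ 2 - (2 * b * (3 * b + 2)) * 6 = 4) ∧ ((-2 : ℤ) ^ 2 - (4 * b + 2) * 0 = 4) ∧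
    (2 * (-3 * b) * (-2 * (3 * b + 1)) - (3 * b ^ 2 - 1) * 6 - (2 * b * (3 * b + 2)) * 3 = 6) ∧
    (2 * (-3 * b) * (-2) - (3 * b ^ 2 - 1) * 0 - (4 * b + 2) * 3 = -6) ∧
    (3 * (2 * (-b) * (-2 * (3 * b + 1)) - b ^ 2 * 6 - (2 * b * (3 * b + 2)) * 1) = 0) ∧
    (2 * 0 * (-2 * (3 * b + 1)) - 1 * 6 - (2 * b * (3 * b + 2)) * 0 = (-6 : ℤ)) ∧
    (2 * 0 * (-2) - 1 * 0 - (4 * b + 2) * 0 = (0 : ℤ)) ∧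
    (3 * (2 * (-b) * (-2) - b ^ 2 * 0 - (4 * b + 2) * 1) = -6) ∧
    (((b + 1) - b) ^ 2 - 3 * b ^ 2 = 1 - 3 * b ^ 2) ∧
    (2 * (3 * b) * (3 * b + 2) = 3 * (2 * b * (3 * b + 2)) ∧ -2 * (3 * b + 1) = -2 * (3 * b + 1) ∧ (2 : ℤ) * 3 = 6) ∧
    (4 * (3 * b) + 6 = 3 * (4 * b + 2)) := by
  refine ⟨by ring, by simp, by ring, by ring, by ring, by ring, by ring, by ring, by ring, by ring, by ring, by ring, by ring,
    ⟨by ring, rfl, by norm_num⟩, by ring⟩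

/-- **The second family, class map (report §12.4).** Congruence by the automorph `g₀″(b) = [[2+3b, −3],[3b²−1, 2−3b]]` of the form of `v′_b`
fixes `v′_b`, preserves norm and the pairing with `v′_b`, and on a class with `⟨v′_b,w⟩ = 6` written as `(r, c, 3σ)` with `r = −2bc − (3b²−1)σ −
2` it acts by `c′ = (12b+7)c + 12(3b²−1)σ + 6(3b+2)`, `σ′ = −4c − (12b−7)σ − 6` — the FIRST family's recursion (`pg7_psi_step`) at `m = 3b` —
with `χ(⊕S_z, w) = −3⟨u_S,w⟩ = 3σ − 6` and `χ(P_x,w) = 3σ`; on the `B₁` side (`⟨v′_b,w⟩ = −6`, `r = −2bc − (3b²−1)σ + 2`) the constants flip and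
`χ(⊕S_z,w) = 3σ + 6`, `χ(P_x,w) = 3σ`. So invariant (J) of `pg7_invariant_J` (with `m = 3b ≥ 6`) runs the whole orbit. [shadow: `ring`] -/
theorem pg7_family2_step (b r c σ : ℤ) :
    (((2 + 3 * b) ^ 2 * (3 * b ^ 2 - 1) + 2 * (2 + 3 * b) * (3 * b ^ 2 - 1) * (-3 * b) + (3 * b ^ 2 - 1) ^ 2 * 3,
      (2 + 3 * b) * (-3) * (3 * b ^ 2 - 1) + ((2 + 3 * b) * (2 - 3 * b) + (-3) * (3 * b ^ 2 - 1)) * (-3 * b) + (3 * b ^ 2 - 1) * (2 - 3 * b) * 3,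
      (-3) ^ 2 * (3 * b ^ 2 - 1) + 2 * (-3) * (2 - 3 * b) * (-3 * b) + (2 - 3 * b) ^ 2 * 3) = (3 * b ^ 2 - 1, -3 * b, (3 : ℤ))) ∧
    (((2 + 3 * b) * (-3) * r + ((2 + 3 * b) * (2 - 3 * b) + (-3) * (3 * b ^ 2 - 1)) * c + (3 * b ^ 2 - 1) * (2 - 3 * b) * (3 * σ)) ^ 2
      - ((2 + 3 * b) ^ 2 * r + 2 * (2 + 3 * b) * (3 * b ^ 2 - 1) * c + (3 * b ^ 2 - 1) ^ 2 * (3 * σ))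
        * ((-3) ^ 2 * r + 2 * (-3) * (2 - 3 * b) * c + (2 - 3 * b) ^ 2 * (3 * σ)) = c ^ 2 - r * (3 * σ)) ∧
    (r = -2 * b * c - (3 * b ^ 2 - 1) * σ - 2 →
      ((2 + 3 * b) * (-3) * r + ((2 + 3 * b) * (2 - 3 * b) + (-3) * (3 * b ^ 2 - 1)) * c + (3 * b ^ 2 - 1) * (2 - 3 * b) * (3 * σ)
          = (12 * b + 7) * c + 12 * (3 * b ^ 2 - 1) * σ + 6 * (3 * b + 2)) ∧
      ((-3) ^ 2 * r + 2 * (-3) * (2 - 3 * b) * c + (2 - 3 * b) ^ 2 * (3 * σ) = 3 * (-4 * c - (12 * b - 7) * σ - 6)) ∧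
      (-3 * (2 * (-b) * c - b ^ 2 * (3 * σ) - r * 1) = 3 * σ - 6) ∧ (-(2 * 0 * c - 1 * (3 * σ) - r * 0) = 3 * σ) ∧
      ((12 * b + 7) * c + 12 * (3 * b ^ 2 - 1) * σ + 6 * (3 * b + 2) = (4 * (3 * b) + 7) * c + 4 * ((3 * b) ^ 2 - 3) * σ + 6 * (3 * b + 2)) ∧
      (-4 * c - (12 * b - 7) * σ - 6 = -4 * c - (4 * (3 * b) - 7) * σ - 6)) ∧
    (r = -2 * b * c - (3 * b ^ 2 - 1) * σ + 2 →
      (-3 * (2 * (-b) * c - b ^ 2 * (3 * σ) - r * 1) = 3 * σ + 6) ∧ (-(2 * 0 * c - 1 * (3 * σ) - r * 0) = 3 * σ)) := by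
  refine ⟨?_, by ring, ?_, ?_⟩
  · simp only [Prod.mk.injEq]; exact ⟨by ring, by ring, by ring⟩
  · intro hr; subst hr; exact ⟨by ring, by ring, by ring, by ring, by ring, by ring⟩
  · intro hr; subst hr; exact ⟨by ring, by ring⟩

/-! ### ADDENDUM 2 — route (R2): the residuals halved (report §13) -/

/-- **LEMMA R2, the dimension counts (report §13.1).** In the smooth 6-fold `𝓑`, at a MIXED jump point the jump locus contains the intersection of
a one-sign Hom-locus of Eagon–Northcott codimension `≤ 1` (ranks `(h,h,0)`: `h − h + 1`) and a one-sign Ext¹-locus of codimension `≤ χ^σ + 1 = 4`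
(ranks `(e, e + 3)`: `(e+3) − e + 1`), so it has dimension `≥ 6 − 1 − 4 = 1` by Serre's inequality: not isolated; only the DOUBLE jump (two
conditions of codimension `≤ 4`, expected dimension `6 − 8 = −2 < 0`) can be isolated. The Euler halves are `χ^± = 6/2 = 3` on the non-neutral
piece and `0` on the neutral one in all three settings ((1,2), `D(m,0)`, `(b,b+1)`). [shadow: the arithmetic] -/
theorem pg7_r2_dims (h e : ℕ) :
    ((h : ℤ) - h + 1 = 1) ∧ (((e : ℤ) + 3) - e + 1 = 4) ∧ ((6 : ℤ) - 1 - 4 = 1 ∧ (1 : ℤ) ≤ 6 - 1 - 4) ∧ ((6 : ℤ) - 4 - 4 = -2 ∧ (6 : ℤ) - 4 - 4 < 0) ∧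
    ((6 : ℤ) / 2 = 3 ∧ (0 : ℤ) / 2 = 0) ∧ (3 + 1 = (4 : ℤ)) := by
  refine ⟨by ring, by ring, ⟨by norm_num, by norm_num⟩, ⟨by norm_num, by norm_num⟩, ⟨by norm_num, by norm_num⟩, by norm_num⟩

end ProductGroundSeven

end Summit.HodgeConjecture.HodgeConjecture.WeilTypeLadder
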